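import Literature.MathematicalPhysics.QuantumFieldTheory.Balaban1983to89.B3Ineq25ZeroLattice

/-!
# `Balaban1983to89.B3Ineq31ZeroLattice` — T. Bałaban, *(Higgs)₂,₃ quantum fields in a finite volume. III. Renormalization*,
# Commun. Math. Phys. **88** (1983) 411–445 [Balaban1983Higgs3]: inequality (3.1) p. 432,
# `‖hG_k(Ω,B̃)h′‖_{1,α} ≤ O(1)e^{−δ₀dist(□(v),□(v′))}`, PROVED for the §3 propagator itself — the MODEL INSTANCE `A = B̃ = 0`,
# `Ω = ηℤ^{d+1}` (p. 433: *"with the scalar field propagator equal to G_k(0)"*), unit-cube localizations `□(v), □(v′)` ANYWHERE on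
# the infinite lattice at distance `≥ 1`, every scale `k ≥ 1`, every Hölder exponent `0 ≤ α < 1` — r15's
# `B3Sect3Statements.Sect3Data.Ineq31 α δ₀ C` DISCHARGED for the concrete carrier `sect3ZeroLattice` (the norm (1.32) of
# `1_{□(v)}G_k(0)1_{□(v′)}` defined INTRINSICALLY on `ηℤ^{d+1} × ηℤ^{d+1}`), by `G_k(0) = G_k(□,0) − δG_k(□,ηℤ^{d+1},0)` on a box `□`
# around the two cubes: (3.1) for the box (`B3Ineq31ZeroBox`, gen 4) plus (2.5) for `δG_k(□,ηℤ^{d+1},0)` (`B3Ineq25ZeroLattice`, gen 8)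

statement-level skeleton of published theorems with citation tags; proofs where landed; nothing here is a claim about the Yang–Mills mass gap

PDF held: `paper:balaban1983-higgs-2-3-quantum-fields-finite-volume` (journal page = PDF page + 410); p. 420 [PDF 10] ((1.32) and
«This definition extends in a natural way to functions of many variables … we localize simply by representing Ω₁ as a sum of unit
cubes»), p. 432 [PDF 22] ((3.1)), p. 433 [PDF 23] (*"we substitute G_k(□,0) = G_k(0) + δG_k(□,ηZ^d,0)"*, *"with the scalar field
propagator equal to G_k(0)"*) read in the OCR text (`p0010.txt`, `p0022.txt`, `p0023.txt`).

CITATION HEADER (lean-in-tree rule).  Part of the lit-balaban TYPED SKELETON (HOME `run/shared/lean/pub/lit-balaban/`), Phase 2: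
SKELETON row **B3.Eq3.1** (decl of record `B3Sect3Statements.Sect3Data.Ineq31`, fold owner r15; proved members: zero-field box
`B3Ineq31ZeroBox.ineq31_zeroBox` (p03 g4), zero-field torus `B3Ineq31ZeroTorus` (p03 g5), constant-field box `B3Ineq31ConstBox`
(p03 g7)) — the INFINITE-LATTICE member for the print's own §3 propagator `G_k(0) = B3GkZeroLattice.GkLat` (p03 g8); also row
**B3.Txt@433**.

WHAT IS PRINTED.  p. 432 [PDF 22], verbatim: *"Such a possibility is assured by the following estimates
‖hG_k(Ω,B̃)h′‖_{1,α} ≤ O(1)e^{−δ₀dist(□(v),□(v′))}, (3.1) and similarly for the vector field propagator, h, h′ are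
localization functions."* (text layer p0022 L17; v1.1 erratum, ref-4 S-B3-g32-1 2026-08-22); p. 433: *"After all these
operations we get a sum of the expressions E(G_ren,{□(v)}_{v∈G_ren},Φ_ext,A_ext) … with the scalar field propagator equal to
G_k(0). … We apply the decomposition (2.6) to the propagators G_k(0)"* — i.e. §3 runs the estimates for the infinite-volume
propagator `G_k(0)`.

WHAT IS REPRODUCED, and how (kind «model-instance», G.1 of `HOME/PHASE2-TARGETS.md`).
* §1 INTRINSIC OBJECTS on the infinite lattice: the fine points `cubePts` of a unit cube `□(v)` (`mem_cubePts_iff`: `⌊x/L^k⌋ = v`),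
  the localization domain `sitesZ = □(v) × □(v′)` and its bonds `bondsZ` (row bonds inside `□(v)`, column bonds inside `□(v′)`,
  indexed `(direction, base point, shifted site)` exactly as `B3Ineq31ZeroBox.sites/bonds`), the two-variable field
  `kerZ (x,x′) = η^{−(d+1)}G_k(0)(x,x′)` (`G_k(0) = B3GkZeroLattice.GkLat`), its lattice derivatives `derivZ` in all `2(d+1)`
  directions, `dirOfZ`, `baseOfZ`, the product sup-distance `pdistZ`, and **`normHGH α v v′ = ‖1_{□(v)}G_k(0)1_{□(v′)}‖_{1,α}`** = the
  printed (1.32) SUM form `B3Sect1Statements.norm132` (transport `U ≡ 1`) over these sets — the same reading as every (3.1)/(2.5)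
  member of the lineage, now on `ηℤ^{d+1}`; the carrier `sect3ZeroLattice ℓ k a m2 : Sect3Data` (`LocFn = ℤ^{d+1}` labels of unit
  cubes, `distCubes = B3Ineq31ZeroBox.cubeDist`, the (3.2)–(3.5) data not modelled, as in `B3Ineq31ZeroBox`), `ineq31_iff` (Iff.rfl);
* §2 two facts about the (1.32) SUM norm with identity transport: INVARIANCE under an isomorphism of the index sets intertwining
  fields, derivatives, directions and distances (`norm132_transfer`) and SUBADDITIVITY (`norm132_sub_le`);
* §3 THE CHART: for labels `v, v′` the block offset `chartW = min(v,v′) − 3` and the box `□ = w + Π[0, chartM)`,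
  `chartM_i = |v_i − v′_i| + 7`, containing both cubes at CUBE DEPTH `3` (`cubeDepth_chart_left/right`) with the same cube distance
  (`cubeDist_chart`); every fine point of `□(v) ∪ □(v′)` has chart coordinates in the fine box (`sub_nW_mem`, `blk_sub_nW`,
  `blk_add_nW`); **THE SPLITTING** `η^{−(d+1)}G_k(0)(y+nw,y′+nw) = η^{−(d+1)}G_k(□,0)(y,y′) − η^{−(d+1)}δG_k(□,ηℤ^{d+1},0)(y,y′)`
  (`kerZ_chart`: block-lattice invariance `B3GkZeroLattice.GkLat_shift` + the definition of `B3DeltaGkZeroLattice.dGkLat`); hence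
  `normHGH_eq_chart`: the intrinsic norm EQUALS the (1.32) norm over the chart box's index sets (`B3Ineq31ZeroBox.sites/bonds` at
  the labels `v − w`, `v′ − w`) of `kerF − kerD`, `derivF − derivD` (by `norm132_transfer` along the translation), and
  `normHGH_le_box_add_delta`: `‖1_{□(v)}G_k(0)1_{□(v′)}‖_{1,α} ≤ ‖1G_k(□,0)1‖_{1,α} + ‖1δG_k(□,ηℤ^{d+1},0)1‖_{1,α}`
  (`B3Ineq31ZeroBox.normHGH` + `B3Ineq25ZeroLattice.normHGH` on the chart box);
* §4 **`ineq31_zeroLattice`**: `∀ 0 ≤ α < 1 ∃ δ₀ C > 0 ∀ k ≥ 1, window: (sect3ZeroLattice ℓ k a m2).Ineq31 α δ₀ C` — from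
  `B3Ineq31ZeroBox.ineq31_zeroBox` (the chart box; cube distance `≥ 1` preserved) and `B3Ineq25ZeroLattice.ineq25_zeroLattice`
  (depth `r₀ = 3`, `e^{−3δ} ≤ 1`) at the common rate `min(δ₁,δ₂)`, constant `C₁ + C₂`; §5 `ineq31_zeroLattice_witness`.

HONEST SCOPE / DECLARED DIVERGENCES (F7).  (i) Zero field (`U ≡ 1`, one component), `G_k(0)` the kernel limit of
`B3GkZeroLattice` (its identification with any other infinite-volume construction is not claimed), all `k ≥ 1`, `L ≥ 2`, window
`[a₋,a₊] × [0,m²₊]`; localizations = indicators of unit cubes (p. 420), sup-norm distances `× η`, `dist(□(v),□(v′)) =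
B3Ineq31ZeroBox.cubeDist`; «similarly for the vector field propagator» not treated.  (ii) The (1.32) norm of the two-variable
field: SUM form, derivatives in all `2(d+1)` lattice directions along bonds inside the cubes, Hölder quotients over same-direction
bond pairs at the product sup-distance — the lineage's reading of «extends in a natural way to functions of many variables», stated
here intrinsically on `ηℤ^{d+1} × ηℤ^{d+1}`.  (iii) Constants existential (on `d`, `L`, the window, `α`).  (iv) ROUTE: not the
print's multiscale argument but the p. 433 splitting itself, `G_k(0) = G_k(□,0) − δG_k(□,ηℤ^{d+1},0)` on a box adapted to the pair
of cubes, with BOTH summands controlled by landed theorems used BY NAME (`ineq31_zeroBox`, `ineq25_zeroLattice`); theorems + `def`s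
with bodies, no Literature fact minted, no `sorry`; standard axioms.  Value = (3.1) for the propagator §3 actually uses, zero-field
instance, NOT summit progress.
Unit `lit-balaban-p03` (Phase-2 proof seat p03, gen 8); HOME `run/shared/lean/pub/lit-balaban/` (rows B3.Eq3.1 / B3.Txt@433).
-/

namespace Literature.MathematicalPhysics.QuantumFieldTheory.Balaban1983to89.B3Ineq31ZeroLattice

open Finset Matrix
open Literature.MathematicalPhysics.QuantumFieldTheory.Balaban1983to89.B4ContourShift (supNorm supNorm_nonneg
  abs_le_supNorm exists_supNorm_eq)
open Literature.MathematicalPhysics.QuantumFieldTheory.Balaban1983to89.B4TwoRegion120 (supNorm_sub_comm)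
open Literature.MathematicalPhysics.QuantumFieldTheory.Balaban1983to89.B4Reflection242
open Literature.MathematicalPhysics.QuantumFieldTheory.Balaban1983to89.B4TwoBox120
open Literature.MathematicalPhysics.QuantumFieldTheory.Balaban1983to89.B4Thm110ZeroBox
open Literature.MathematicalPhysics.QuantumFieldTheory.Balaban1983to89.B3GkZeroLattice
open Literature.MathematicalPhysics.QuantumFieldTheory.Balaban1983to89.B3DeltaGkZeroLattice
open Literature.MathematicalPhysics.QuantumFieldTheory.Balaban1983to89.B3Ineq31ZeroBox (cubeDist cubeDist_nonneg
  sites bonds dirOf baseOf pdist kerF derivF sect3ZeroBox ineq31_zeroBox)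
open Literature.MathematicalPhysics.QuantumFieldTheory.Balaban1983to89.B3Ineq25ZeroLattice (CubeDepth kerD derivD
  sect2DeltaZeroLattice ineq25_zeroLattice)
open Literature.MathematicalPhysics.QuantumFieldTheory.Balaban1983to89.B3Sect1Statements (norm132 norm132_nonneg)
open Literature.MathematicalPhysics.QuantumFieldTheory.Balaban1983to89.B3Sect3Statements
open LatticeNorms (norm_le_supNorm supNorm_le holderSeminorm_le holder_bound holderSeminorm_nonneg)

noncomputable section

variable {d : ℕ}

/-! ## §1 The unit cubes of `ηℤ^{d+1}`, the two-variable field `η^{−(d+1)}G_k(0)` on `□(v) × □(v′)`, its lattice derivatives, its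
norm (1.32) — all intrinsic on the infinite lattice — and the carrier -/

section Lattice

variable (ℓ k : ℕ)

/-- The fine points of the unit cube `□(v) = Π_i [v_i, v_i + 1)` of the `L^kη = 1`-lattice, in integer coordinates of `ηℤ^{d+1}`
(`n = L^k = η^{−1}` points per unit length): `Π_i [n v_i, n v_i + n)`. [cite: Balaban1983Higgs3, (3.1) p.432] -/
def cubePts (v : Fin (d + 1) → ℤ) : Finset (Fin (d + 1) → ℤ) :=
  Fintype.piFinset fun i =>
    Finset.Ico ((((ℓ + 1) ^ k : ℕ) : ℤ) * v i) ((((ℓ + 1) ^ k : ℕ) : ℤ) * v i + (((ℓ + 1) ^ k : ℕ) : ℤ))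

/-- `x ∈ □(v)` iff its block label `⌊x/L^k⌋` is `v`. [cite: Balaban1983Higgs3, (3.1) p.432] -/
theorem mem_cubePts_iff {v x : Fin (d + 1) → ℤ} : x ∈ cubePts ℓ k v ↔ blk ((ℓ + 1) ^ k) x = v := by
  have hn : (0 : ℤ) < (((ℓ + 1) ^ k : ℕ) : ℤ) := by positivity
  simp only [cubePts, Fintype.mem_piFinset, Finset.mem_Ico]
  rw [funext_iff]
  refine forall_congr' fun i => ?_
  have hb : blk ((ℓ + 1) ^ k) x i = x i / (((ℓ + 1) ^ k : ℕ) : ℤ) := rfl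
  rw [hb]
  have ec : (((ℓ + 1) ^ k : ℕ) : ℤ) * v i = v i * (((ℓ + 1) ^ k : ℕ) : ℤ) := mul_comm _ _
  rw [ec]
  constructor
  · rintro ⟨h1, h2⟩
    apply le_antisymm
    · have h3 : x i / (((ℓ + 1) ^ k : ℕ) : ℤ) < v i + 1 :=
        (Int.ediv_lt_iff_lt_mul hn).2 (by rw [add_mul, one_mul]; exact h2)
      omega
    · exact (Int.le_ediv_iff_mul_le hn).2 h1
  · intro h
    have h1 := (Int.le_ediv_iff_mul_le hn).1 h.ge
    have h2 := (Int.ediv_lt_iff_lt_mul hn).1 (show x i / (((ℓ + 1) ^ k : ℕ) : ℤ) < v i + 1 by omega)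
    rw [add_mul, one_mul] at h2
    exact ⟨h1, h2⟩

/-- The localization domain `□(v) × □(v′)` of the product lattice `ηℤ^{d+1} × ηℤ^{d+1}`. [cite: Balaban1983Higgs3, (3.1) p.432] -/
def sitesZ (v v' : Fin (d + 1) → ℤ) : Finset ((Fin (d + 1) → ℤ) × (Fin (d + 1) → ℤ)) :=
  cubePts ℓ k v ×ˢ cubePts ℓ k v'

/-- membership in `□(v) × □(v′)` by block labels. [cite: Balaban1983Higgs3, (3.1) p.432] -/
theorem mem_sitesZ_iff {v v' : Fin (d + 1) → ℤ} {z : (Fin (d + 1) → ℤ) × (Fin (d + 1) → ℤ)} :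
    z ∈ sitesZ ℓ k v v' ↔ blk ((ℓ + 1) ^ k) z.1 = v ∧ blk ((ℓ + 1) ^ k) z.2 = v' := by
  simp only [sitesZ, Finset.mem_product, mem_cubePts_iff]

/-- Lattice bonds of the product lattice inside `□(v) × □(v′)`, indexed as `(direction, base point, shifted site)` exactly as
`B3Ineq31ZeroBox.bonds`: a ROW bond `inl (μ, (x,x′), x+e_μ)` (both `x, x+e_μ ∈ □(v)`) or a COLUMN bond `inr (ν, (x,x′), x′+e_ν)`
(both `x′, x′+e_ν ∈ □(v′)`) — the index set of the derivatives `D^η_μ` of (1.32) for a function of the `2(d+1)` lattice variables.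
[cite: Balaban1983Higgs3, (1.32) p.420] -/
def bondsZ (v v' : Fin (d + 1) → ℤ) :
    Finset ((Fin (d + 1) × (((Fin (d + 1) → ℤ) × (Fin (d + 1) → ℤ)) × (Fin (d + 1) → ℤ))) ⊕
      (Fin (d + 1) × (((Fin (d + 1) → ℤ) × (Fin (d + 1) → ℤ)) × (Fin (d + 1) → ℤ)))) :=
  ((univ ×ˢ (sitesZ ℓ k v v' ×ˢ cubePts ℓ k v)).filter fun b => b.2.2 = b.2.1.1 + Pi.single b.1 1).disjSum
    ((univ ×ˢ (sitesZ ℓ k v v' ×ˢ cubePts ℓ k v')).filter fun b => b.2.2 = b.2.1.2 + Pi.single b.1 1)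

/-- membership of a row bond. [cite: Balaban1983Higgs3, (1.32) p.420] -/
theorem inl_mem_bondsZ_iff {v v' : Fin (d + 1) → ℤ}
    {b : Fin (d + 1) × (((Fin (d + 1) → ℤ) × (Fin (d + 1) → ℤ)) × (Fin (d + 1) → ℤ))} :
    Sum.inl b ∈ bondsZ ℓ k v v' ↔
      b.2.1 ∈ sitesZ ℓ k v v' ∧ b.2.2 = b.2.1.1 + Pi.single b.1 1 ∧ blk ((ℓ + 1) ^ k) b.2.2 = v := by
  simp only [bondsZ, Finset.inl_mem_disjSum, Finset.mem_filter, Finset.mem_product, Finset.mem_univ, true_and,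
    mem_cubePts_iff]
  tauto

/-- membership of a column bond. [cite: Balaban1983Higgs3, (1.32) p.420] -/
theorem inr_mem_bondsZ_iff {v v' : Fin (d + 1) → ℤ}
    {b : Fin (d + 1) × (((Fin (d + 1) → ℤ) × (Fin (d + 1) → ℤ)) × (Fin (d + 1) → ℤ))} :
    Sum.inr b ∈ bondsZ ℓ k v v' ↔
      b.2.1 ∈ sitesZ ℓ k v v' ∧ b.2.2 = b.2.1.2 + Pi.single b.1 1 ∧ blk ((ℓ + 1) ^ k) b.2.2 = v' := by
  simp only [bondsZ, Finset.inr_mem_disjSum, Finset.mem_filter, Finset.mem_product, Finset.mem_univ, true_and,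
    mem_cubePts_iff]
  tauto

variable (a m2 : ℝ)

/-- **The two-variable field of (3.1) for the §3 propagator**: `F(x,x′) = η^{−(d+1)}G_k(0)(x,x′)` on `ηℤ^{d+1} × ηℤ^{d+1}`
(`G_k(0) = B3GkZeroLattice.GkLat`, matrix units, so `F` is the kernel in the print's `η^{d+1}`-normalisation
`(Gf)(x) = Σ_{x′}η^{d+1}G(x,x′)f(x′)`). [cite: Balaban1983Higgs3, (3.1) p.432] -/
def kerZ (z : (Fin (d + 1) → ℤ) × (Fin (d + 1) → ℤ)) : ℝ :=
  ((((ℓ + 1) ^ k : ℕ)) : ℝ) ^ (d + 1) * GkLat ℓ k a m2 z.1 z.2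

/-- The lattice derivatives `∂^ηF` along the product-lattice bonds: `η^{−1}(F(x+e_μ,x′) − F(x,x′))` on a row bond,
`η^{−1}(F(x,x′+e_ν) − F(x,x′))` on a column bond (`U ≡ 1` at `B̃ = 0`). [cite: Balaban1983Higgs3, (1.32) p.420] -/
def derivZ : ((Fin (d + 1) × (((Fin (d + 1) → ℤ) × (Fin (d + 1) → ℤ)) × (Fin (d + 1) → ℤ))) ⊕
    (Fin (d + 1) × (((Fin (d + 1) → ℤ) × (Fin (d + 1) → ℤ)) × (Fin (d + 1) → ℤ)))) → ℝ :=
  Sum.elim (fun b => (((ℓ + 1) ^ k : ℕ) : ℝ) * (kerZ ℓ k a m2 (b.2.2, b.2.1.2) - kerZ ℓ k a m2 b.2.1))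
    (fun b => (((ℓ + 1) ^ k : ℕ) : ℝ) * (kerZ ℓ k a m2 (b.2.1.1, b.2.2) - kerZ ℓ k a m2 b.2.1))

/-- The direction of a bond (one of the `2(d+1)` directions of the product lattice). [cite: Balaban1983Higgs3, (1.32) p.420] -/
def dirOfZ : ((Fin (d + 1) × (((Fin (d + 1) → ℤ) × (Fin (d + 1) → ℤ)) × (Fin (d + 1) → ℤ))) ⊕
    (Fin (d + 1) × (((Fin (d + 1) → ℤ) × (Fin (d + 1) → ℤ)) × (Fin (d + 1) → ℤ)))) → Fin (d + 1) ⊕ Fin (d + 1) :=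
  Sum.elim (fun b => Sum.inl b.1) (fun b => Sum.inr b.1)

/-- The base point `(x, x′)` of a bond. [cite: Balaban1983Higgs3, (1.32) p.420] -/
def baseOfZ : ((Fin (d + 1) × (((Fin (d + 1) → ℤ) × (Fin (d + 1) → ℤ)) × (Fin (d + 1) → ℤ))) ⊕
    (Fin (d + 1) × (((Fin (d + 1) → ℤ) × (Fin (d + 1) → ℤ)) × (Fin (d + 1) → ℤ)))) →
      (Fin (d + 1) → ℤ) × (Fin (d + 1) → ℤ) :=
  Sum.elim (fun b => b.2.1) (fun b => b.2.1)

/-- The sup-distance `|z − z′|` of two points of the product lattice in `η`-units: `η·max(|x − y|_∞, |x′ − y′|_∞)`.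
[cite: Balaban1983Higgs3, (1.32) p.420] -/
def pdistZ (z z' : (Fin (d + 1) → ℤ) × (Fin (d + 1) → ℤ)) : ℝ :=
  max (supNorm (z.1 - z'.1)) (supNorm (z.2 - z'.2)) / (((ℓ + 1) ^ k : ℕ) : ℝ)

/-- **‖1_{□(v)}G_k(0)1_{□(v′)}‖_{1,α}**: the printed (1.32) SUM form `B3Sect1Statements.norm132` — `sup|F| + sup|∂F| +
sup|∂F(b′) − ∂F(b)|/|z(b) − z(b′)|^α` over same-direction bond pairs — of `F = η^{−(d+1)}G_k(0)` on the localization domain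
`□(v) × □(v′) ⊂ ηℤ^{d+1} × ηℤ^{d+1}`, derivatives in all `2(d+1)` directions, transport `U ≡ id` (`B̃ = 0`) — the reading of
«This definition extends in a natural way to functions of many variables» (p. 420) of the whole (3.1) lineage
(`B3Ineq31ZeroBox.normHGH`), here on the infinite lattice. [cite: Balaban1983Higgs3, (3.1) p.432] -/
def normHGH (α : ℝ) (v v' : Fin (d + 1) → ℤ) : ℝ :=
  norm132 α (fun c c' => dirOfZ c = dirOfZ c') (fun c c' => pdistZ ℓ k (baseOfZ c) (baseOfZ c')) (fun _ _ => id)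
    (sitesZ ℓ k v v') (bondsZ ℓ k v v') (kerZ ℓ k a m2) (derivZ ℓ k a m2)

/-- `‖1_{□(v)}G_k(0)1_{□(v′)}‖_{1,α} ≥ 0`. [cite: Balaban1983Higgs3, (3.1) p.432] -/
theorem normHGH_nonneg (α : ℝ) (v v' : Fin (d + 1) → ℤ) : 0 ≤ normHGH ℓ k a m2 α v v' := norm132_nonneg _ _ _ _ _ _ _ _

end Lattice

/-- **The concrete carrier of B3 §3 for the MODEL INSTANCE `A = B̃ = 0`, `Ω = ηℤ^{d+1}` (the §3 propagator `G_k(0)`, p. 433)**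
with the (3.1) fields modelled as in `B3Ineq31ZeroBox.sect3ZeroBox`: `LocFn` = the unit cubes `□(v)` of `ηℤ^{d+1}` (labels
`v ∈ ℤ^{d+1}`), `distCubes = dist(□(v),□(v′))` (`B3Ineq31ZeroBox.cubeDist`), `normHGH α v v′ = ‖1_{□(v)}G_k(0)1_{□(v′)}‖_{1,α}`;
the data of (3.2)–(3.5) NOT modelled (`RenClass′ = ∅`, `e(L^kε) = λ(L^kε) = 0`). [cite: Balaban1983Higgs3, (3.1) p.432] -/
def sect3ZeroLattice (ℓ k : ℕ) (a m2 : ℝ) : Sect3Data where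
  eRun := 0
  lamRun := 0
  LocFn := Fin (d + 1) → ℤ
  distCubes := cubeDist
  normHGH := normHGH ℓ k a m2
  RenClass' := PEmpty
  Loc := fun G => G.elim
  ExtS := PUnit
  ExtV := PUnit
  E' := fun G => G.elim
  E3 := fun G => G.elim
  dv := fun G => G.elim
  ds := fun G => G.elim
  normS := fun _ _ => 0
  normV := fun _ _ => 0
  lhs35 := fun G => G.elim
  GenFamily := fun G => G.elim
  rhs35 := fun G => G.elim
  PosAlongOrderings := fun G => G.elim

/-- `(3.1)` for the carrier unfolds to the bound on `normHGH`. [cite: Balaban1983Higgs3, (3.1) p.432] -/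
theorem ineq31_iff (ℓ k : ℕ) (a m2 : ℝ) (α δ₀ C : ℝ) :
    (sect3ZeroLattice (d := d) ℓ k a m2).Ineq31 α δ₀ C ↔
      ∀ v v' : Fin (d + 1) → ℤ, 1 ≤ cubeDist v v' →
        normHGH ℓ k a m2 α v v' ≤ C * Real.exp (-(δ₀ * cubeDist v v')) := Iff.rfl

/-! ## §2 Two facts about the printed (1.32) SUM norm with identity transport: invariance under an isomorphism of the index
sets, and subadditivity -/

/-- **INVARIANCE OF (1.32) UNDER RE-INDEXING**: if `e`, `eb` map the site and bond index sets ONTO the primed ones, intertwining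
the fields, the derivative families, the directions and the distances, then the (1.32) SUM norms (identity transport) agree.
[cite: Balaban1983Higgs3, (1.32) p.420] -/
theorem norm132_transfer {ι κ ι' κ' D E : Type*} [SeminormedAddCommGroup E] (α : ℝ) (dir : κ → D) (dir' : κ' → D)
    (distD : κ → κ → ℝ) (distD' : κ' → κ' → ℝ) (S : Finset ι) (S' : Finset ι') (SD : Finset κ) (SD' : Finset κ')
    (f : ι → E) (f' : ι' → E) (Df : κ → E) (Df' : κ' → E) (e : ι → ι') (eb : κ → κ')
    (hS : ∀ x ∈ S, e x ∈ S') (hS' : ∀ x' ∈ S', ∃ x ∈ S, e x = x')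
    (hSD : ∀ c ∈ SD, eb c ∈ SD') (hSD' : ∀ c' ∈ SD', ∃ c ∈ SD, eb c = c')
    (hf : ∀ x, f' (e x) = f x) (hDf : ∀ c, Df' (eb c) = Df c) (hdir : ∀ c, dir' (eb c) = dir c)
    (hdist : ∀ c c', distD' (eb c) (eb c') = distD c c') :
    norm132 α (fun c c' => dir' c = dir' c') distD' (fun _ _ => id) S' SD' f' Df' =
      norm132 α (fun c c' => dir c = dir c') distD (fun _ _ => id) S SD f Df := by
  unfold norm132
  have h1 : LatticeNorms.supNorm S' f' = LatticeNorms.supNorm S f := by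
    apply le_antisymm
    · refine supNorm_le (LatticeNorms.supNorm_nonneg _ _) fun x' hx' => ?_
      obtain ⟨x, hx, rfl⟩ := hS' x' hx'
      rw [hf]; exact norm_le_supNorm f hx
    · refine supNorm_le (LatticeNorms.supNorm_nonneg _ _) fun x hx => ?_
      rw [← hf]; exact norm_le_supNorm f' (hS x hx)
  have h2 : LatticeNorms.supNorm SD' Df' = LatticeNorms.supNorm SD Df := by
    apply le_antisymm
    · refine supNorm_le (LatticeNorms.supNorm_nonneg _ _) fun c' hc' => ?_
      obtain ⟨c, hc, rfl⟩ := hSD' c' hc'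
      rw [hDf]; exact norm_le_supNorm Df hc
    · refine supNorm_le (LatticeNorms.supNorm_nonneg _ _) fun c hc => ?_
      rw [← hDf]; exact norm_le_supNorm Df' (hSD c hc)
  have h3 : LatticeNorms.holderSeminorm α (fun c c' => dir' c = dir' c') distD' (fun _ _ => id) SD' Df' =
      LatticeNorms.holderSeminorm α (fun c c' => dir c = dir c') distD (fun _ _ => id) SD Df := by
    apply le_antisymm
    · refine holderSeminorm_le (holderSeminorm_nonneg _ _ _ _ _ _) fun c' hc' c₂' hc₂' had hpos => ?_
      obtain ⟨c, hc, rfl⟩ := hSD' c' hc'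
      obtain ⟨c₂, hc₂, rfl⟩ := hSD' c₂' hc₂'
      replace had : dir c = dir c₂ := by have h : dir' (eb c) = dir' (eb c₂) := had; rwa [hdir, hdir] at h
      rw [hdist] at hpos ⊢
      have hb := holder_bound (α := α) (adm := fun c c' => dir c = dir c') (τ := fun _ _ => id) Df hc hc₂ had hpos
      simp only [id_eq] at hb ⊢
      rw [hDf, hDf]; exact hb
    · refine holderSeminorm_le (holderSeminorm_nonneg _ _ _ _ _ _) fun c hc c₂ hc₂ had hpos => ?_
      replace had : dir c = dir c₂ := had
      have had' : dir' (eb c) = dir' (eb c₂) := by rw [hdir, hdir]; exact had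
      have hpos' : 0 < distD' (eb c) (eb c₂) := by rw [hdist]; exact hpos
      have hb := holder_bound (α := α) (adm := fun c c' => dir' c = dir' c') (τ := fun _ _ => id) Df' (hSD c hc)
        (hSD c₂ hc₂) had' hpos'
      simp only [id_eq] at hb ⊢
      rw [hDf, hDf, hdist] at hb; exact hb
  rw [h1, h2, h3]

/-- **SUBADDITIVITY OF THE PRINTED (1.32) SUM NORM** (identity transport): `‖f − g‖_{1,α} ≤ ‖f‖_{1,α} + ‖g‖_{1,α}` for
`norm132 = sup|·| + sup|D·| + Hölder seminorm of D·` over any finite index sets. [cite: Balaban1983Higgs3, (1.32) p.420] -/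
theorem norm132_sub_le {ι κ E : Type*} [SeminormedAddCommGroup E] (α : ℝ) (sameDir : κ → κ → Prop) (distD : κ → κ → ℝ)
    (S : Finset ι) (SD : Finset κ) (f g : ι → E) (Df Dg : κ → E) :
    norm132 α sameDir distD (fun _ _ => id) S SD (fun x => f x - g x) (fun c => Df c - Dg c)
      ≤ norm132 α sameDir distD (fun _ _ => id) S SD f Df + norm132 α sameDir distD (fun _ _ => id) S SD g Dg := by
  unfold norm132
  have h1 : LatticeNorms.supNorm S (fun x => f x - g x) ≤ LatticeNorms.supNorm S f + LatticeNorms.supNorm S g :=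
    supNorm_le (add_nonneg (LatticeNorms.supNorm_nonneg _ _) (LatticeNorms.supNorm_nonneg _ _)) fun x hx =>
      (norm_sub_le (f x) (g x)).trans (add_le_add (norm_le_supNorm f hx) (norm_le_supNorm g hx))
  have h2 : LatticeNorms.supNorm SD (fun c => Df c - Dg c) ≤ LatticeNorms.supNorm SD Df + LatticeNorms.supNorm SD Dg :=
    supNorm_le (add_nonneg (LatticeNorms.supNorm_nonneg _ _) (LatticeNorms.supNorm_nonneg _ _)) fun c hc =>
      (norm_sub_le (Df c) (Dg c)).trans (add_le_add (norm_le_supNorm Df hc) (norm_le_supNorm Dg hc))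
  have h3 : LatticeNorms.holderSeminorm α sameDir distD (fun _ _ => id) SD (fun c => Df c - Dg c)
      ≤ LatticeNorms.holderSeminorm α sameDir distD (fun _ _ => id) SD Df
        + LatticeNorms.holderSeminorm α sameDir distD (fun _ _ => id) SD Dg := by
    refine holderSeminorm_le (add_nonneg (holderSeminorm_nonneg _ _ _ _ _ _) (holderSeminorm_nonneg _ _ _ _ _ _))
      fun c hc c' hc' hadm hpos => ?_
    have hf := holder_bound (α := α) (τ := fun _ _ => id) Df hc hc' hadm hpos
    have hg := holder_bound (α := α) (τ := fun _ _ => id) Dg hc hc' hadm hpos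
    simp only [id_eq] at hf hg ⊢
    calc ‖Df c' - Dg c' - (Df c - Dg c)‖ = ‖(Df c' - Df c) - (Dg c' - Dg c)‖ := by congr 1; abel
      _ ≤ ‖Df c' - Df c‖ + ‖Dg c' - Dg c‖ := norm_sub_le _ _
      _ ≤ _ := by rw [add_mul]; exact add_le_add hf hg
  linarith

/-! ## §3 The chart: a box around the two cubes at depth 3, and `G_k(0) = G_k(□,0) − δG_k(□,ηℤ^{d+1},0)` read in it -/

section Chart

/-- The block offset of the chart: `w = min(v,v′) − 3` componentwise. [cite: Balaban1983Higgs3, (3.1) p.432] -/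
def chartW (v v' : Fin (d + 1) → ℤ) : Fin (d + 1) → ℤ := fun i => min (v i) (v' i) - 3

/-- The chart box `□ = w + Π[0, |v_i − v′_i| + 7)` of unit blocks (as a box `Π[0,M)` in coordinates relative to `w`).
[cite: Balaban1983Higgs3, (3.1) p.432] -/
def chartM (v v' : Fin (d + 1) → ℤ) : Fin (d + 1) → ℕ := fun i => (v i - v' i).natAbs + 7

/-- the chart box is non-degenerate. [cite: Balaban1983Higgs3, (3.1) p.432] -/
theorem chartM_pos (v v' : Fin (d + 1) → ℤ) (i : Fin (d + 1)) : 1 ≤ chartM v v' i := by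
  unfold chartM; omega

/-- the first cube sits in the chart box at cube depth `3`. [cite: Balaban1983Higgs3, (3.1) p.432] -/
theorem cubeDepth_chart_left (v v' : Fin (d + 1) → ℤ) : CubeDepth (chartM v v') 3 (v - chartW v v') := fun i => by
  simp only [chartM, chartW, Pi.sub_apply]
  omega

/-- the second cube sits in the chart box at cube depth `3`. [cite: Balaban1983Higgs3, (3.1) p.432] -/
theorem cubeDepth_chart_right (v v' : Fin (d + 1) → ℤ) : CubeDepth (chartM v v') 3 (v' - chartW v v') := fun i => by
  simp only [chartM, chartW, Pi.sub_apply]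
  omega

/-- the chart preserves the cube distance. [cite: Balaban1983Higgs3, (3.1) p.432] -/
theorem cubeDist_chart (v v' : Fin (d + 1) → ℤ) : cubeDist (v - chartW v v') (v' - chartW v v') = cubeDist v v' := by
  unfold B3Ineq31ZeroBox.cubeDist
  rw [sub_sub_sub_cancel_right]

variable (ℓ k : ℕ) (v v' : Fin (d + 1) → ℤ)

/-- the fine translation vector `n·w` of the chart. [cite: Balaban1983Higgs3, (3.1) p.432] -/
def nW : Fin (d + 1) → ℤ := fun i => ((((ℓ + 1) ^ k : ℕ)) : ℤ) * chartW v v' i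

variable {ℓ k v v'}

/-- block labels under the chart translation. [cite: Balaban1983Higgs3, (3.1) p.432] -/
theorem blk_add_nW (x : Fin (d + 1) → ℤ) : blk ((ℓ + 1) ^ k) (x + nW ℓ k v v') = blk ((ℓ + 1) ^ k) x + chartW v v' :=
  blk_add_mul (Nat.one_le_pow _ _ (Nat.succ_pos ℓ)) x (chartW v v')

/-- block labels under the inverse chart translation. [cite: Balaban1983Higgs3, (3.1) p.432] -/
theorem blk_sub_nW (x : Fin (d + 1) → ℤ) : blk ((ℓ + 1) ^ k) (x - nW ℓ k v v') = blk ((ℓ + 1) ^ k) x - chartW v v' := by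
  have h := blk_add_nW (ℓ := ℓ) (k := k) (v := v) (v' := v') (x - nW ℓ k v v')
  rw [sub_add_cancel] at h
  rw [h, add_sub_cancel_right]

/-- **every fine point of `□(v) ∪ □(v′)` has chart coordinates `x − nw` in the fine box of the chart box**: no point (hence no
bond) of `□(v) × □(v′)` is lost in the chart. [cite: Balaban1983Higgs3, (3.1) p.432] -/
theorem sub_nW_mem {x : Fin (d + 1) → ℤ} (hx : blk ((ℓ + 1) ^ k) x = v ∨ blk ((ℓ + 1) ^ k) x = v') :
    x - nW ℓ k v v' ∈ boxDom (Nf ℓ k (chartM v v')) := by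
  have hn : 1 ≤ (ℓ + 1) ^ k := Nat.one_le_pow _ _ (Nat.succ_pos ℓ)
  have hn0 : (0 : ℤ) < (((ℓ + 1) ^ k : ℕ) : ℤ) := by exact_mod_cast hn
  have hlab := blk_sub_nW (ℓ := ℓ) (k := k) (v := v) (v' := v') x
  have hdep : CubeDepth (chartM v v') 3 (blk ((ℓ + 1) ^ k) x - chartW v v') := by
    rcases hx with h | h <;> rw [h]
    · exact cubeDepth_chart_left v v'
    · exact cubeDepth_chart_right v v'
  rw [mem_boxDom]
  intro i
  obtain ⟨h1, h2⟩ := hdep i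
  have hl := congr_fun hlab i
  simp only [Pi.sub_apply] at hl h1 h2 ⊢
  have hb : blk ((ℓ + 1) ^ k) (x - nW ℓ k v v') i = (x i - nW ℓ k v v' i) / (((ℓ + 1) ^ k : ℕ) : ℤ) := rfl
  rw [hb] at hl
  have e1 : 0 ≤ (x i - nW ℓ k v v' i) / (((ℓ + 1) ^ k : ℕ) : ℤ) := by rw [hl]; linarith
  have e2 : (x i - nW ℓ k v v' i) / (((ℓ + 1) ^ k : ℕ) : ℤ) + 1 ≤ (chartM v v' i : ℤ) := by rw [hl]; linarith
  constructor
  · by_contra hneg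
    rw [not_le] at hneg
    have : (x i - nW ℓ k v v' i) / (((ℓ + 1) ^ k : ℕ) : ℤ) < 0 := Int.ediv_neg_of_neg_of_pos hneg hn0
    linarith
  · have h3 := Int.lt_ediv_add_one_mul_self (x i - nW ℓ k v v' i) hn0
    have h4 := mul_le_mul_of_nonneg_right e2 hn0.le
    show x i - nW ℓ k v v' i < (((ℓ + 1) ^ k * chartM v v' i : ℕ) : ℤ)
    rw [Nat.cast_mul]
    linarith

variable (ℓ k v v')

/-- the chart on pairs of fine points: chart coordinates `(y,y′) ↦ (y + nw, y′ + nw)` actual lattice points. [folklore] -/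
private def eSite (z : ↥(boxDom (Nf ℓ k (chartM v v'))) × ↥(boxDom (Nf ℓ k (chartM v v')))) :
    (Fin (d + 1) → ℤ) × (Fin (d + 1) → ℤ) :=
  (z.1.1 + nW ℓ k v v', z.2.1 + nW ℓ k v v')

/-- the chart on bonds. [folklore] -/
private def eBond : ((Fin (d + 1) × ((↥(boxDom (Nf ℓ k (chartM v v'))) × ↥(boxDom (Nf ℓ k (chartM v v')))) ×
      ↥(boxDom (Nf ℓ k (chartM v v'))))) ⊕
    (Fin (d + 1) × ((↥(boxDom (Nf ℓ k (chartM v v'))) × ↥(boxDom (Nf ℓ k (chartM v v')))) ×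
      ↥(boxDom (Nf ℓ k (chartM v v')))))) →
    ((Fin (d + 1) × (((Fin (d + 1) → ℤ) × (Fin (d + 1) → ℤ)) × (Fin (d + 1) → ℤ))) ⊕
      (Fin (d + 1) × (((Fin (d + 1) → ℤ) × (Fin (d + 1) → ℤ)) × (Fin (d + 1) → ℤ)))) :=
  Sum.map (fun b => (b.1, (eSite ℓ k v v' b.2.1, b.2.2.1 + nW ℓ k v v')))
    (fun b => (b.1, (eSite ℓ k v v' b.2.1, b.2.2.1 + nW ℓ k v v')))

variable {ℓ k v v'} {a m2 : ℝ}

/-- **THE SPLITTING IN THE CHART**: `η^{−(d+1)}G_k(0)(y+nw,y′+nw) = η^{−(d+1)}G_k(□,0)(y,y′) − η^{−(d+1)}δG_k(□,ηℤ^{d+1},0)(y,y′)`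
on the chart box (block-lattice invariance `B3GkZeroLattice.GkLat_shift` + the definition of `dGkLat`):
`kerZ ∘ chart = B3Ineq31ZeroBox.kerF − B3Ineq25ZeroLattice.kerD`. [cite: Balaban1983Higgs3, p.433 («we substitute G_k(□,0) = G_k(0) + δG_k(□,ηZ^d,0)»)] -/
theorem kerZ_chart (hℓ : 1 ≤ ℓ) (hk : 1 ≤ k) (ha : 0 < a) (hm : 0 ≤ m2)
    (z : ↥(boxDom (Nf ℓ k (chartM v v'))) × ↥(boxDom (Nf ℓ k (chartM v v')))) :
    kerZ ℓ k a m2 (z.1.1 + nW ℓ k v v', z.2.1 + nW ℓ k v v') =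
      kerF ℓ k (chartM v v') a m2 z - kerD ℓ k (chartM v v') a m2 z := by
  simp only [kerZ, B3Ineq31ZeroBox.kerF, B3Ineq25ZeroLattice.kerD, dGkLat]
  unfold nW
  rw [GkLat_shift hℓ hk ha hm]
  ring

/-- **`‖1_{□(v)}G_k(0)1_{□(v′)}‖_{1,α}` READ IN THE CHART**: the intrinsic lattice norm equals the (1.32) norm, over the index sets
of the chart box at the chart labels `v − w`, `v′ − w`, of the field `η^{−(d+1)}(G_k(□,0) − δG_k(□,ηℤ^{d+1},0))` (the chart is a
translation: an isomorphism of the index sets preserving directions, distances and — by `kerZ_chart` — the fields).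
[cite: Balaban1983Higgs3, (3.1) p.432] -/
theorem normHGH_eq_chart (hℓ : 1 ≤ ℓ) (hk : 1 ≤ k) (ha : 0 < a) (hm : 0 ≤ m2) (α : ℝ) (v v' : Fin (d + 1) → ℤ) :
    normHGH ℓ k a m2 α v v' =
      norm132 α (fun c c' => dirOf ℓ k (chartM v v') c = dirOf ℓ k (chartM v v') c')
        (fun c c' => pdist ℓ k (chartM v v') (baseOf ℓ k (chartM v v') c) (baseOf ℓ k (chartM v v') c'))
        (fun _ _ => id) (sites ℓ k (chartM v v') (v - chartW v v') (v' - chartW v v'))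
        (bonds ℓ k (chartM v v') (v - chartW v v') (v' - chartW v v'))
        (fun z => kerF ℓ k (chartM v v') a m2 z - kerD ℓ k (chartM v v') a m2 z)
        (fun c => derivF ℓ k (chartM v v') a m2 c - derivD ℓ k (chartM v v') a m2 c) := by
  have hn : 1 ≤ (ℓ + 1) ^ k := Nat.one_le_pow _ _ (Nat.succ_pos ℓ)
  -- the fields agree along the chart
  have hf : ∀ z, kerZ ℓ k a m2 (eSite ℓ k v v' z) =
      kerF ℓ k (chartM v v') a m2 z - kerD ℓ k (chartM v v') a m2 z := fun z => kerZ_chart hℓ hk ha hm z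
  have hDf : ∀ c, derivZ ℓ k a m2 (eBond ℓ k v v' c) =
      derivF ℓ k (chartM v v') a m2 c - derivD ℓ k (chartM v v') a m2 c := by
    rintro (b | b)
    · simp only [eBond, Sum.map_inl, derivZ, Sum.elim_inl, B3Ineq31ZeroBox.derivF, B3Ineq25ZeroLattice.derivD]
      rw [show ((b.2.2.1 + nW ℓ k v v', (eSite ℓ k v v' b.2.1).2) : (Fin (d + 1) → ℤ) × (Fin (d + 1) → ℤ)) =
        eSite ℓ k v v' (b.2.2, b.2.1.2) from rfl, hf, hf]
      ring
    · simp only [eBond, Sum.map_inr, derivZ, Sum.elim_inr, B3Ineq31ZeroBox.derivF, B3Ineq25ZeroLattice.derivD]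
      rw [show (((eSite ℓ k v v' b.2.1).1, b.2.2.1 + nW ℓ k v v') : (Fin (d + 1) → ℤ) × (Fin (d + 1) → ℤ)) =
        eSite ℓ k v v' (b.2.1.1, b.2.2) from rfl, hf, hf]
      ring
  -- sites correspond
  have hS : ∀ z ∈ sites ℓ k (chartM v v') (v - chartW v v') (v' - chartW v v'), eSite ℓ k v v' z ∈ sitesZ ℓ k v v' := by
    intro z hz
    simp only [B3Ineq31ZeroBox.sites, Finset.mem_filter, Finset.mem_univ, true_and] at hz
    rw [mem_sitesZ_iff]
    simp only [eSite, blk_add_nW, hz.1, hz.2, sub_add_cancel, and_self]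
  have hS' : ∀ z' ∈ sitesZ ℓ k v v', ∃ z ∈ sites ℓ k (chartM v v') (v - chartW v v') (v' - chartW v v'),
      eSite ℓ k v v' z = z' := by
    intro z' hz'
    rw [mem_sitesZ_iff] at hz'
    refine ⟨(⟨z'.1 - nW ℓ k v v', sub_nW_mem (Or.inl hz'.1)⟩, ⟨z'.2 - nW ℓ k v v', sub_nW_mem (Or.inr hz'.2)⟩), ?_, ?_⟩
    · simp only [B3Ineq31ZeroBox.sites, Finset.mem_filter, Finset.mem_univ, blk_sub_nW, hz'.1, hz'.2, and_self]
    · simp only [eSite, sub_add_cancel, Prod.mk.eta]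
  -- bonds correspond
  have hSD : ∀ c ∈ bonds ℓ k (chartM v v') (v - chartW v v') (v' - chartW v v'), eBond ℓ k v v' c ∈ bondsZ ℓ k v v' := by
    rintro (b | b) hb
    · simp only [B3Ineq31ZeroBox.bonds, Finset.inl_mem_disjSum, Finset.mem_filter, Finset.mem_univ, true_and] at hb
      obtain ⟨hb1, hb2, hb3⟩ := hb
      simp only [eBond, Sum.map_inl, inl_mem_bondsZ_iff]
      refine ⟨hS _ hb1, ?_, ?_⟩
      · simp only [eSite, hb2]; abel
      · rw [blk_add_nW, hb3, sub_add_cancel]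
    · simp only [B3Ineq31ZeroBox.bonds, Finset.inr_mem_disjSum, Finset.mem_filter, Finset.mem_univ, true_and] at hb
      obtain ⟨hb1, hb2, hb3⟩ := hb
      simp only [eBond, Sum.map_inr, inr_mem_bondsZ_iff]
      refine ⟨hS _ hb1, ?_, ?_⟩
      · simp only [eSite, hb2]; abel
      · rw [blk_add_nW, hb3, sub_add_cancel]
  have hSD' : ∀ c' ∈ bondsZ ℓ k v v', ∃ c ∈ bonds ℓ k (chartM v v') (v - chartW v v') (v' - chartW v v'),
      eBond ℓ k v v' c = c' := by
    rintro (b | b) hb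
    · rw [inl_mem_bondsZ_iff] at hb
      obtain ⟨hb1, hb2, hb3⟩ := hb
      rw [mem_sitesZ_iff] at hb1
      refine ⟨Sum.inl (b.1, ((⟨b.2.1.1 - nW ℓ k v v', sub_nW_mem (Or.inl hb1.1)⟩,
          ⟨b.2.1.2 - nW ℓ k v v', sub_nW_mem (Or.inr hb1.2)⟩), ⟨b.2.2 - nW ℓ k v v', sub_nW_mem (Or.inl hb3)⟩)), ?_, ?_⟩
      · simp only [B3Ineq31ZeroBox.bonds, Finset.inl_mem_disjSum, Finset.mem_filter, Finset.mem_univ, true_and,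
          B3Ineq31ZeroBox.sites, blk_sub_nW, hb1.1, hb1.2, hb3, and_self, true_and, and_true]
        rw [hb2]; abel
      · simp only [eBond, Sum.map_inl, eSite, sub_add_cancel]
    · rw [inr_mem_bondsZ_iff] at hb
      obtain ⟨hb1, hb2, hb3⟩ := hb
      rw [mem_sitesZ_iff] at hb1
      refine ⟨Sum.inr (b.1, ((⟨b.2.1.1 - nW ℓ k v v', sub_nW_mem (Or.inl hb1.1)⟩,
          ⟨b.2.1.2 - nW ℓ k v v', sub_nW_mem (Or.inr hb1.2)⟩), ⟨b.2.2 - nW ℓ k v v', sub_nW_mem (Or.inr hb3)⟩)), ?_, ?_⟩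
      · simp only [B3Ineq31ZeroBox.bonds, Finset.inr_mem_disjSum, Finset.mem_filter, Finset.mem_univ, true_and,
          B3Ineq31ZeroBox.sites, blk_sub_nW, hb1.1, hb1.2, hb3, and_self, true_and, and_true]
        rw [hb2]; abel
      · simp only [eBond, Sum.map_inr, eSite, sub_add_cancel]
  -- directions and distances correspond
  have hdir : ∀ c, dirOfZ (eBond ℓ k v v' c) = dirOf ℓ k (chartM v v') c := by
    rintro (b | b) <;> rfl
  have hdist : ∀ c c', pdistZ ℓ k (baseOfZ (eBond ℓ k v v' c)) (baseOfZ (eBond ℓ k v v' c')) =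
      pdist ℓ k (chartM v v') (baseOf ℓ k (chartM v v') c) (baseOf ℓ k (chartM v v') c') := by
    rintro (b | b) (b' | b') <;>
      simp only [eBond, Sum.map_inl, Sum.map_inr, baseOfZ, Sum.elim_inl, Sum.elim_inr, B3Ineq31ZeroBox.baseOf, pdistZ,
        B3Ineq31ZeroBox.pdist, eSite, add_sub_add_right_eq_sub]
  unfold normHGH
  exact norm132_transfer α (dirOf ℓ k (chartM v v')) dirOfZ _ _ _ _ _ _ _ _ _ _ (eSite ℓ k v v') (eBond ℓ k v v')
    hS hS' hSD hSD' hf hDf hdir hdist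

/-- **`‖1_{□(v)}G_k(0)1_{□(v′)}‖_{1,α} ≤ ‖1G_k(□,0)1‖_{1,α} + ‖1δG_k(□,ηℤ^{d+1},0)1‖_{1,α}`** on the chart box (cubes at the
chart labels `v − w`, `v′ − w`): the lattice norm is dominated by the gen-4 box norm `B3Ineq31ZeroBox.normHGH` plus the
gen-8 norm `B3Ineq25ZeroLattice.normHGH` of `δG_k`. [cite: Balaban1983Higgs3, (3.1) p.432] -/
theorem normHGH_le_box_add_delta (hℓ : 1 ≤ ℓ) (hk : 1 ≤ k) (ha : 0 < a) (hm : 0 ≤ m2) (α : ℝ) (v v' : Fin (d + 1) → ℤ) :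
    normHGH ℓ k a m2 α v v' ≤
      B3Ineq31ZeroBox.normHGH ℓ k (chartM v v') a m2 α (v - chartW v v') (v' - chartW v v')
        + B3Ineq25ZeroLattice.normHGH ℓ k (chartM v v') a m2 α (v - chartW v v') (v' - chartW v v') := by
  rw [normHGH_eq_chart hℓ hk ha hm]
  exact norm132_sub_le α _ _ _ _ _ _ _ _

end Chart

/-! ## §4 (3.1) DISCHARGED for `G_k(0)`, for each Hölder exponent `0 ≤ α < 1` -/

/-- kernel: lowering the rate of an exponential bound at a non-negative distance. [folklore] -/
private theorem exp_rate_le {δ δ₁ D : ℝ} (hδ₁ : δ ≤ δ₁) (hD : 0 ≤ D) : Real.exp (-(δ₁ * D)) ≤ Real.exp (-(δ * D)) :=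
  Real.exp_le_exp.2 (by nlinarith)

/-- **B3 (3.1) — `‖hG_k(Ω,B̃)h′‖_{1,α} ≤ O(1)e^{−δ₀dist(□(v),□(v′))}` — DISCHARGED for the §3 propagator `G_k(0)` on `ηℤ^{d+1}`
(MODEL INSTANCE `A = B̃ = 0`, `Ω` = the whole lattice), for each Hölder exponent `0 ≤ α < 1`:** there are `δ₀ = δ₀(α) > 0`,
`C = C(α) > 0` (on `d`, `L`, the window, `α`) such that for every scale `k ≥ 1` and window point `(sect3ZeroLattice ℓ k a m2).Ineq31
α δ₀ C` holds, i.e. for ALL unit cubes `□(v), □(v′)` of the lattice with `dist(□(v),□(v′)) ≥ 1`: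
`‖1_{□(v)}η^{−(d+1)}G_k(0)1_{□(v′)}‖_{1,α} ≤ C·e^{−δ₀·dist(□(v),□(v′))}`.  Print (3.1) p. 432 and p. 433 *"with the scalar field
propagator equal to G_k(0)"*.  Proof: `G_k(0) = G_k(□,0) − δG_k(□,ηℤ^{d+1},0)` read in the chart box around the two cubes
(`normHGH_le_box_add_delta`), (3.1) for the box (`B3Ineq31ZeroBox.ineq31_zeroBox`), (2.5) for `δG_k` at depth 3
(`B3Ineq25ZeroLattice.ineq25_zeroLattice`, `e^{−3δ} ≤ 1`), common rate `min`. [cite: Balaban1983Higgs3, (3.1) p.432] -/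
theorem ineq31_zeroLattice (d ℓ : ℕ) (hℓ : 1 ≤ ℓ) (amin aplus m2plus : ℝ) (ha : 0 < amin) {α : ℝ} (hα0 : 0 ≤ α)
    (hα1 : α < 1) :
    ∃ δ₀ C : ℝ, 0 < δ₀ ∧ 0 < C ∧ ∀ (k : ℕ), 1 ≤ k → ∀ (a m2 : ℝ), amin ≤ a → a ≤ aplus → 0 ≤ m2 → m2 ≤ m2plus →
      (sect3ZeroLattice (d := d) ℓ k a m2).Ineq31 α δ₀ C := by
  obtain ⟨δ₁, C₁, hδ₁, hC₁, h₁⟩ := ineq31_zeroBox d ℓ hℓ amin aplus m2plus ha hα0 hα1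
  obtain ⟨δ₂, C₂, hδ₂, hC₂, h₂⟩ := ineq25_zeroLattice d ℓ hℓ amin aplus m2plus ha hα0 hα1
  refine ⟨min δ₁ δ₂, C₁ + C₂, lt_min hδ₁ hδ₂, add_pos hC₁ hC₂, ?_⟩
  intro k hk a m2 ha1 ha2 hm1 hm2
  rw [ineq31_iff]
  intro v v' hD
  have ha0 : 0 < a := ha.trans_le ha1
  have hDn : 0 ≤ cubeDist v v' := cubeDist_nonneg v v'
  set M := chartM v v' with hM
  set u := v - chartW v v' with hu
  set u' := v' - chartW v v' with hu'
  have hDu : cubeDist u u' = cubeDist v v' := cubeDist_chart v v'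
  -- (3.1) for the chart box
  have hbox := (B3Ineq31ZeroBox.ineq31_iff ℓ k M a m2 α δ₁ C₁).1 (h₁ k hk a m2 ha1 ha2 hm1 hm2 M (chartM_pos v v')) u u'
    (by rw [hDu]; exact hD)
  -- (2.5) for `δG_k(□,ηℤ^{d+1},0)` at depth 3
  have hdel := ((B3Ineq25ZeroLattice.ineq25_iff (ℓ := ℓ) (k := k) (hℓ := hℓ) (M := M) (a := a) (m2 := m2) (r₀ := 3) α δ₂ C₂).1
    (h₂ k hk a m2 ha1 ha2 hm1 hm2 M (chartM_pos v v') 3 le_rfl)).1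
    ⟨u, cubeDepth_chart_left v v'⟩ ⟨u', cubeDepth_chart_right v v'⟩
  simp only at hdel
  rw [hDu] at hbox hdel
  have e3 : Real.exp (-(δ₂ * ((3 : ℕ) : ℝ))) ≤ 1 := Real.exp_le_one_iff.2 (by norm_num; exact hδ₂.le)
  have hE₁ := exp_rate_le (min_le_left δ₁ δ₂) hDn
  have hE₂ := exp_rate_le (min_le_right δ₁ δ₂) hDn
  have hE₀ : 0 ≤ Real.exp (-(δ₂ * cubeDist v v')) := (Real.exp_pos _).le
  calc normHGH ℓ k a m2 α v v'
      ≤ B3Ineq31ZeroBox.normHGH ℓ k M a m2 α u u' + B3Ineq25ZeroLattice.normHGH ℓ k M a m2 α u u' :=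
        normHGH_le_box_add_delta hℓ hk ha0 hm1 α v v'
    _ ≤ C₁ * Real.exp (-(δ₁ * cubeDist v v')) + C₂ * Real.exp (-(δ₂ * ((3 : ℕ) : ℝ))) * Real.exp (-(δ₂ * cubeDist v v')) :=
        add_le_add hbox hdel
    _ ≤ C₁ * Real.exp (-(δ₁ * cubeDist v v')) + C₂ * 1 * Real.exp (-(δ₂ * cubeDist v v')) := by
        have := mul_le_mul_of_nonneg_right (mul_le_mul_of_nonneg_left e3 hC₂.le) hE₀
        linarith
    _ ≤ C₁ * Real.exp (-(min δ₁ δ₂ * cubeDist v v')) + C₂ * 1 * Real.exp (-(min δ₁ δ₂ * cubeDist v v')) :=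
        add_le_add (mul_le_mul_of_nonneg_left hE₁ hC₁.le) (mul_le_mul_of_nonneg_left hE₂ (by linarith [hC₂.le]))
    _ = (C₁ + C₂) * Real.exp (-(min δ₁ δ₂ * cubeDist v v')) := by ring

/-! ## §5 Non-vacuity: the binders are inhabited (`d + 1 = 3`, `L = 2`, `k = 1`, window `[1,1] × [0,0]`, `α = 1/2`; the cubes
`□(0)` and `□((2,2,2))` are at cube distance `1`) -/

/-- `dist(□(0), □((2,2,2))) = 1`. [folklore] -/
private theorem witness_cubeDist : cubeDist (fun _ : Fin 3 => (0 : ℤ)) (fun _ : Fin 3 => (2 : ℤ)) = 1 := by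
  unfold B3Ineq31ZeroBox.cubeDist
  have h : supNorm ((fun _ : Fin 3 => (0 : ℤ)) - fun _ : Fin 3 => (2 : ℤ)) = 2 := by
    obtain ⟨i, hi⟩ := exists_supNorm_eq ((fun _ : Fin 3 => (0 : ℤ)) - fun _ : Fin 3 => (2 : ℤ))
    rw [hi]; simp
  rw [h]; norm_num

/-- The constants of `ineq31_zeroLattice` exist and (3.1) is a genuine inequality at the witness pair of cubes.
[cite: Balaban1983Higgs3, (3.1) p.432] -/
theorem ineq31_zeroLattice_witness :
    ∃ δ₀ C : ℝ, 0 < δ₀ ∧ 0 < C ∧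
      (sect3ZeroLattice (d := 2) 1 1 (1 : ℝ) (0 : ℝ)).Ineq31 (1 / 2) δ₀ C ∧
      normHGH (d := 2) 1 1 (1 : ℝ) (0 : ℝ) (1 / 2) (fun _ => (0 : ℤ)) (fun _ => (2 : ℤ)) ≤ C * Real.exp (-(δ₀ * 1)) := by
  obtain ⟨δ₀, C, hδ₀, hC, h⟩ := ineq31_zeroLattice 2 1 le_rfl 1 1 0 one_pos (α := 1 / 2) (by norm_num) (by norm_num)
  have h1 := h 1 le_rfl 1 0 le_rfl le_rfl le_rfl le_rfl
  refine ⟨δ₀, C, hδ₀, hC, h1, ?_⟩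
  have h2 := (ineq31_iff (d := 2) 1 1 1 0 (1 / 2) δ₀ C).1 h1 (fun _ => 0) (fun _ => 2) (by rw [witness_cubeDist])
  rwa [witness_cubeDist] at h2

end

end Literature.MathematicalPhysics.QuantumFieldTheory.Balaban1983to89.B3Ineq31ZeroLattice
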